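import Summits.KontsevichZagierPeriods.KontsevichZagierPeriods.Theorems.HurwitzMicroSectorsNormalFormPrincipleM4DilationMoves
import Summits.KontsevichZagierPeriods.KontsevichZagierPeriods.Theorems.HurwitzMicroSectorsNormalFormPrincipleL2W3RelationsDilation
import Summits.KontsevichZagierPeriods.KontsevichZagierPeriods.Theorems.HyperbolicBlochOffTetraSectorKernelStubAffineOrbit
import Literature.NumberTheory.Transcendental.KZProductIdeal

/-!
# `NormalFormPrinciple` (stmt-KontsevichZagierPeriods-3869), line `SketchIdeator1` —
# leaf `stub_boxRigidity`, layer `M4` packages: the partial dilations `2P(ab,ac) − P(ab,ab)`,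
# `2P(ac,ac) − P(ab,ac)` in the product ideal

Pure proof file (registered sub-goal `m4_rel_pdil4` of stmt-KontsevichZagierPeriods-3869, line
`SketchIdeator1`, lead seat c9; layer `M4` packages of the dimension-four campaign of the leaf
`stub_boxRigidity`; `--supports` the crux). Letters on `(0,1)`: `a(u) = 1/u`, `b(u) = 1/(1−u)`,
`c(u) = 1/(1+u)`; the weight-two words `[ab] = [Δ₂, a(t₀)b(t₁)]` (`= ζ(2)`) and
`[ac] = [Δ₂, a(t₀)c(t₁)]` (`= −Li₂(−1) = ζ(2)/2`) live on the decreasing open simplex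
`Δ₂ = {1 > t₀ > t₁ > 0}`, and `P(u,v) = [U.prod V] = [U] * [V]` is the product representation
(`KZ.IntegralRep.prod`, `KZ.of_mul_of`).

* The weight-two DILATION relation `2[ac] − [ab] ∈ KZ.relations` (`m4y_two_ac_sub_ab`): ONE change
  of variables `t ↦ t²` of `Δ₂` onto itself (rule (2), the landed move `m4_dilation_moves`, second
  conjunct, which also supplies the pulled-back carrier `N`), whose Jacobian pulls the letters
  back as `a(s²)·2s = 2a(s)`, `b(s²)·2s = b(s) − c(s)` (`l2v_dilation_letter_pulls`), followed by
  integrand additivity (rule (1b), `aff_orbit_of_sub_sum_zsmul_mem_relations`):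
  `[N] = 2[ab] − 2[ac]`, whence `[ab] = 2[ab] − 2[ac]`.
* The PRODUCT IDEAL (`KZ.of_mul_mem_relations`, `KZ.mul_mem_relations_right_holds`: Fubini inside
  the calculus, Kontsevich–Zagier §4.1): multiplying on the left by `[ab]` gives
  `2P(ab,ac) − P(ab,ab) ∈ KZ.relations`, multiplying on the right by `[ac]` gives
  `2P(ac,ac) − P(ab,ac) ∈ KZ.relations`.

Sources: M. Kontsevich, D. Zagier, *Periods* (2001), §1.2 rules (1b), (2), §4.1.
No definitions are introduced.
-/

noncomputable section

open MeasureTheory Set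
open Literature.NumberTheory.Transcendental Literature.NumberTheory.Transcendental.KZ
open Summit.KontsevichZagierPeriods.HyperbolicBloch.OffTetraSectorKernel
  (aff_orbit_of_sub_sum_zsmul_mem_relations)

namespace Summit.KontsevichZagierPeriods.HurwitzMicroSectors.NormalFormPrinciple.PiBox.M3

/-- **The weight-two dilation relation `2[ac] − [ab] ∈ KZ.relations`** (`ζ(2) = 2·(−Li₂(−1))`
inside the calculus): one dilation move `t ↦ t²` of `Δ₂` (rule 2) applied to `[ab]`, then
integrand additivity (rule 1b) expanding the pulled-back integrand
`(a(s₀²)·2s₀)(b(s₁²)·2s₁) = 2a(s₀)(b(s₁) − c(s₁))` into `2[ab] − 2[ac]`.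
[cite: KontsevichZagier2001, §1.2 rules (1), (2)] -/
theorem m4y_two_ac_sub_ab (AB : IntegralRep 2)
    (hABd : AB.domain = {t | 0 < t 1 ∧ t 1 < t 0 ∧ t 0 < 1})
    (hABi : AB.integrand = fun t => 1 / t 0 * (1 / (1 - t 1)))
    (AC : IntegralRep 2) (hACd : AC.domain = {t | 0 < t 1 ∧ t 1 < t 0 ∧ t 0 < 1})
    (hACi : AC.integrand = fun t => 1 / t 0 * (1 / (1 + t 1))) :
    (2:ℤ) • of AC - of AB ∈ relations := by
  -- the dilation move on the word `a b`
  have hTi : EqOn AB.integrand (fun t => (fun u : ℝ => 1 / u) (t 0) *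
      (fun u : ℝ => 1 / (1 - u)) (t 1)) AB.domain := fun t _ => by
    simp only [hABi]
  obtain ⟨hmove, N, hNd, hNi⟩ := m4_dilation_moves.2 (fun u => 1 / u) (fun u => 1 / (1 - u))
    AB hABd hTi
  have m1 : of N - of AB ∈ relations := hmove N hNd (hNi ▸ fun _ _ => rfl)
  -- rule (1b) on `Δ₂`: `[N] = 2[AB] − 2[AC]`
  have m2 : of N - ((2:ℤ) • of AB + (-2:ℤ) • of AC) ∈ relations := by
    have h := aff_orbit_of_sub_sum_zsmul_mem_relations (Finset.univ : Finset (Fin 2))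
      ![AB, AC] ![2, -2] N (fun i _ => by
        fin_cases i
        · exact hABd.trans hNd.symm
        · exact hACd.trans hNd.symm) fun t ht => ?_
    · simpa [Fin.sum_univ_two] using h
    rw [hNd] at ht
    obtain ⟨h1, h10, h0⟩ := ht
    have h00 : 0 < t 0 := h1.trans h10
    have h11 : t 1 < 1 := h10.trans h0
    rw [hNi]
    simp only [Fin.sum_univ_two, Matrix.cons_val_zero, Matrix.cons_val_one, hABi, hACi]
    rw [(l2v_dilation_letter_pulls h00 h0).1, (l2v_dilation_letter_pulls h1 h11).2]
    push_cast
    ring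
  have e : (2:ℤ) • of AC - of AB =
      (of N - ((2:ℤ) • of AB + (-2:ℤ) • of AC)) - (of N - of AB) := by
    simp only [neg_smul]; abel
  rw [e]
  exact relations.sub_mem m2 m1

/-- **Stub `m4_rel_pdil4` (registered sub-goal of stmt-KontsevichZagierPeriods-3869, line
`SketchIdeator1`, layer `M4` packages).** The two partial dilations of product representations,
`2P(ab,ac) − P(ab,ab) ∈ KZ.relations` and `2P(ac,ac) − P(ab,ac) ∈ KZ.relations`, for arbitrary
carriers `[ab]`, `[ac]` on `Δ₂` with the displayed integrands: the weight-two dilation relation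
`2[ac] − [ab] ∈ KZ.relations` (`m4y_two_ac_sub_ab`: rule (2) + rule (1b)) multiplied on the left by
`[ab]`, resp. on the right by `[ac]`, in the product ideal of the calculus
(`KZ.of_mul_mem_relations`, `KZ.mul_mem_relations_right_holds`, `KZ.of_mul_of`).
[cite: KontsevichZagier2001, §1.2 rules (1), (2), §4.1] -/
theorem m4_rel_pdil4 :
    ∀ (AB : IntegralRep 2), AB.domain = {t | 0 < t 1 ∧ t 1 < t 0 ∧ t 0 < 1} → (AB.integrand = fun t => 1 / t 0 * (1 / (1 - t 1))) →
      ∀ (AC : IntegralRep 2), AC.domain = {t | 0 < t 1 ∧ t 1 < t 0 ∧ t 0 < 1} → (AC.integrand = fun t => 1 / t 0 * (1 / (1 + t 1))) →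
      ((2:ℤ) • of (AB.prod AC) - of (AB.prod AB) ∈ relations) ∧
      ((2:ℤ) • of (AC.prod AC) - of (AB.prod AC) ∈ relations) := by
  intro AB hABd hABi AC hACd hACi
  have r2 : (2:ℤ) • of AC - of AB ∈ relations := m4y_two_ac_sub_ab AB hABd hABi AC hACd hACi
  refine ⟨?_, ?_⟩
  · -- left multiplication by `[ab]`
    have h := of_mul_mem_relations AB r2
    rw [mul_sub, mul_smul_comm, of_mul_of, of_mul_of] at h
    exact h
  · -- right multiplication by `[ac]`
    have h := mul_mem_relations_right_holds _ (of AC) r2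
    rw [sub_mul, smul_mul_assoc, of_mul_of, of_mul_of] at h
    exact h

end Summit.KontsevichZagierPeriods.HurwitzMicroSectors.NormalFormPrinciple.PiBox.M3
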